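import Summits.BirchSwinnertonDyer.BirchSwinnertonDyer.Theorems.Rank1ResidualJetRecordsKitSwap
import Summits.BirchSwinnertonDyer.BirchSwinnertonDyer.Theorems.Rank1ResidualJetCarrierCanonicalDuality
import HarnessLib

/-!
# T1 JET (cell `bsd-jet`), road K — the register ROW KITS (road S, bucket B5) and ONE landed sample row
# RE-KEYED onto the reduced Poitou–Tate input {hUO, hSC}: a booked JET record re-derives from
# {Milne ADT I Thm 2.6 + Thm 4.10(b) ⊇ for THE canonical maps, F1, Gross 3.7 (2), GZK, Kolyvagin, modularity}

HONEST FRAMING (programme file `BSD-LIT2PART-PROGRAMME-v1.md` §HONESTY, verbatim): «no tranche here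
proves BSD; ARM L moves the LITERAL column of an r ≤ 1 census into the kernel-proved-modulo-named-print
column; ARM P changes what «named print» is worth.» THEOREMS ONLY (seat `bsd-jet-pv-1`, session g10;
`--supports stmt-BirchSwinnertonDyer-14418`, helper); nothing is booked, 0 classes move (road K is
DOCUMENTARY; bookings are referee A's). Nothing about any particular curve is asserted beyond the
re-derivation of an already LANDED record under FEWER named inputs.

WHAT. pv-2 g7's kits `JET.bsdp_of_jetRow{A5,B5}_tam_min_of_swapLiterature` and sample row
`JET.bsdpJ_127050cx1_11_of_swapLiterature` (`Rank1ResidualJetRecordsKitSwap.lean`, C2 R939 PASS) display the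
Poitou–Tate binder `hPT : ∀ K, poitouTate_selmerStructure_duality_conj K`. Here the same three statements with
`hPT` REPLACED by the pair (`hUO`, `hSC`) = `UnramifiedOrthogonal` ∧ `SelmerComplement` of THE canonical family
`LocalInvariants.canonical K n` (the other three conjuncts of `hPT` being kernel theorems:
`canonical_isPerfect`, `sumInvLocalizationEqZero_canonical_of_numberField`, `isConjCompatible_canonical`), fed
through `JET.poitouTate_conj_forall_of_canonical` (p574618). Numeric front-ends VERBATIM. Displayed class-free
binders: {`hUO`, `hSC`, `hF1`, `h372`, `hGZK`, `hKo`, `hmod`}. References: [cite: Jetchev2008, Cor. 1.5 (p. 812)]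
[cite: MilneADT2006, Ch. I, Thm. 2.6, Thm. 4.10(b)] [cite: Serre1972, §2.8 Prop. 19] [cite: SilvermanATAEC1994, IV.9.4]
[cite: Cremona2006, Table 1 (label 127050cx1)]. Design: no definitions; `K : Type`. Axioms: `propext`,
`Classical.choice`, `Quot.sound`.
-/

set_option autoImplicit false

noncomputable section

open scoped Classical

open WeierstrassCurve Literature.NumberTheory.EllipticCurves
  Literature.NumberTheory.EllipticCurves.ModularForms Literature.NumberTheory.GaloisCohomology
  Literature.NumberTheory.EllipticCurves.Rank1Residual
  Literature.NumberTheory.EllipticCurves.Rank1Residual.Typed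
  Literature.NumberTheory.EllipticCurves.Rank1Residual.X11RankOneCertificates
  Summit.BirchSwinnertonDyer.BirchSwinnertonDyer.Rank1Residual
  Summit.BirchSwinnertonDyer.BirchSwinnertonDyer.Rank1Residual.IntModel
  Summit.BirchSwinnertonDyer.BirchSwinnertonDyer.Rank1Residual.X11RankOne
  Summit.BirchSwinnertonDyer.BirchSwinnertonDyer.Rank2Observatory.Tam
  Summit.BirchSwinnertonDyer.Rank1Residual Summit.BirchSwinnertonDyer.Rank1Residual.X11b

namespace Summit.BirchSwinnertonDyer.Rank1Residual.JET

/-! ## §1 Road S (bucket A, `p ≥ 5`) ⟸ {hUO, hSC, F1, Gross 3.7 (2), GZK, Kolyvagin, modularity} -/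

/-- **Road S re-keyed onto the reduced Poitou–Tate input**: `bsdp_of_jetRowA5_tam_min_of_swapLiterature` with
`hPT := poitouTate_conj_forall_of_canonical hUO hSC`. Numeric front-end VERBATIM. Displayed: `hUO`, `hSC`,
`hF1`, `h372`, `hGZK`, `hKo`, `hmod` + the row's Heegner/index/analytic data. CONDITIONAL on every binder;
per pair. [cite: Jetchev2008, Cor. 1.5 (p. 812)] [cite: MilneADT2006, Ch. I, Thm. 2.6, Thm. 4.10(b)]
[cite: Serre1972, §2.8 Prop. 19 and §5.2 (iii)] [cite: SilvermanATAEC1994, IV.9.4] -/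
theorem bsdp_of_jetRowA5_tam_min_of_canonicalLiterature (p : ℕ) (hp : p.Prime) (hp5 : 5 ≤ p)
    (a1 a2 a3 a4 a6 : ℤ) (hmin : (⟨a1, a2, a3, a4, a6⟩ : WeierstrassCurve ℚ).IsGloballyMinimal)
    (ℓ₁ ℓ₂ ℓ₃ : ℕ) (hℓ₁ : ℓ₁.Prime) (hℓ₂ : ℓ₂.Prime) (hℓ₃ : ℓ₃.Prime)
    (h2₁ : ℓ₁ ≠ 2) (h2₂ : ℓ₂ ≠ 2) (h2₃ : ℓ₃ ≠ 2) (hne₁ : ℓ₁ ≠ p) (hne₂ : ℓ₂ ≠ p) (hne₃ : ℓ₃ ≠ p)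
    (hΔ₁ : ¬ (ℓ₁ : ℤ) ∣ discOf [a1, a2, a3, a4, a6]) (hΔ₂ : ¬ (ℓ₂ : ℤ) ∣ discOf [a1, a2, a3, a4, a6])
    (hΔ₃ : ¬ (ℓ₃ : ℤ) ∣ discOf [a1, a2, a3, a4, a6])
    {n₁ n₂ n₃ : ℕ} (hc₁ : countPoints [a1, a2, a3, a4, a6] ℓ₁ = n₁)
    (hc₂ : countPoints [a1, a2, a3, a4, a6] ℓ₂ = n₂) (hc₃ : countPoints [a1, a2, a3, a4, a6] ℓ₃ = n₃)
    (r u : ZMod p)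
    (hi : (((ℓ₁ : ℤ) + 1 - n₁ : ℤ) : ZMod p) ^ 2 - 4 * ℓ₁ = r * r ∧
      (((ℓ₁ : ℤ) + 1 - n₁ : ℤ) : ZMod p) ^ 2 - 4 * ℓ₁ ≠ 0 ∧ (((ℓ₁ : ℤ) + 1 - n₁ : ℤ) : ZMod p) ≠ 0)
    (hii : ((((ℓ₂ : ℤ) + 1 - n₂ : ℤ) : ZMod p) ^ 2 - 4 * ℓ₂) ^ (p / 2) = -1 ∧
      (((ℓ₂ : ℤ) + 1 - n₂ : ℤ) : ZMod p) ≠ 0)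
    (hiii : (((ℓ₃ : ℤ) + 1 - n₃ : ℤ) : ZMod p) ^ 2 = u * ℓ₃ ∧
      u ≠ 0 ∧ u ≠ 1 ∧ u ≠ 2 ∧ u ≠ 4 ∧ u ^ 2 - 3 * u + 1 ≠ 0)
    (q : ℕ) (T : TamLocal) (hTq : T.p = q) (hT : T.check ⟨a1, a2, a3, a4, a6⟩ = true)
    {c : ℕ} (hvals : T.vals = [c]) {w : ℕ} (hw : w ≤ padicValNat p c) (hqp : q ≠ p)
    (hUO : ∀ (K : Type) [Field K] [NumberField K] (n : ℕ) [NeZero n],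
      (LocalInvariants.canonical K n).UnramifiedOrthogonal)
    (hSC : ∀ (K : Type) [Field K] [NumberField K] (n : ℕ) [NeZero n],
      (LocalInvariants.canonical K n).SelmerComplement)
    (hF1 : Gross1991_heegnerPoint_sub_ratTorsion_mem_E0)
    (h372 : GrossLMS1991.prop37_2_frobeniusCongruence)
    (hGZK : rank_eq_analyticRank_of_analyticRank_le_one)
    (hKo : ∀ (N : ℕ) [NeZero N] (W : WeierstrassCurve ℚ) (K : Type) [Field K] [NumberField K], kolyvagin N W K)
    (hmod : exists_isNewformOf)
    (W : WeierstrassCurve ℚ) (hW : W = ⟨a1, a2, a3, a4, a6⟩)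
    {N : ℕ} [NeZero N] {K : Type} [Field K] [NumberField K] (hK : IsImaginaryQuadratic K)
    (hD3 : NumberField.discr K ≠ -3) (hD4 : NumberField.discr K ≠ -4)
    (hH : SatisfiesHeegnerHypothesis N K) {P : (W.baseChange K).toAffine.Point}
    (hP : IsHeegnerPoint N W K P) (hnt : ¬ IsOfFinAddOrder P) (hqN : q ∣ N)
    (hv : padicValNat p (AddSubgroup.zmultiples P).index ≤ w)
    (hr : W.analyticRank ≤ 1) {s : ℚ} (hs : shaAn W = (s : ℂ)) (hvs : padicValRat p s = 0) :
    BSDp W p :=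
  bsdp_of_jetRowA5_tam_min_of_swapLiterature p hp hp5 a1 a2 a3 a4 a6 hmin ℓ₁ ℓ₂ ℓ₃ hℓ₁ hℓ₂ hℓ₃ h2₁ h2₂ h2₃
    hne₁ hne₂ hne₃ hΔ₁ hΔ₂ hΔ₃ hc₁ hc₂ hc₃ r u hi hii hiii q T hTq hT hvals hw hqp
    (poitouTate_conj_forall_of_canonical hUO hSC) hF1 h372 hGZK hKo hmod W hW hK hD3 hD4 hH hP hnt hqN hv hr hs
    hvs

/-! ## §2 Bucket B, `p ≥ 5` multiplicative ⟸ {hUO, hSC, F1, Gross 3.7 (2), GZK, Kolyvagin, modularity} -/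

/-- **`bsdp_of_jetRowB5_tam_min` re-keyed onto the reduced Poitou–Tate input** (`hPT :=
poitouTate_conj_forall_of_canonical hUO hSC`). Numeric front-end VERBATIM. Displayed: `hUO`, `hSC`, `hF1`,
`h372`, `hGZK`, `hKo`, `hmod` + the row's data. CONDITIONAL on every binder; per pair.
[cite: Jetchev2008, Cor. 1.5 (p. 812)] [cite: MilneADT2006, Ch. I, Thm. 2.6, Thm. 4.10(b)]
[cite: Serre1972, §2.8 Prop. 19 and §5.2 (iii)] [cite: Wuthrich2014, Lemma 20 (p. 399)] -/
theorem bsdp_of_jetRowB5_tam_min_of_canonicalLiterature (p : ℕ) (hp : p.Prime) (hp5 : 5 ≤ p)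
    (a1 a2 a3 a4 a6 : ℤ) (hmin : (⟨a1, a2, a3, a4, a6⟩ : WeierstrassCurve ℚ).IsGloballyMinimal)
    (hpΔ : (p : ℤ) ∣ (⟨a1, a2, a3, a4, a6⟩ : WeierstrassCurve ℤ).Δ)
    (hpc₄ : ¬ (p : ℤ) ∣ (⟨a1, a2, a3, a4, a6⟩ : WeierstrassCurve ℤ).c₄)
    (ℓ₁ ℓ₂ ℓ₃ : ℕ) (hℓ₁ : ℓ₁.Prime) (hℓ₂ : ℓ₂.Prime) (hℓ₃ : ℓ₃.Prime)
    (h2₁ : ℓ₁ ≠ 2) (h2₂ : ℓ₂ ≠ 2) (h2₃ : ℓ₃ ≠ 2) (hne₁ : ℓ₁ ≠ p) (hne₂ : ℓ₂ ≠ p) (hne₃ : ℓ₃ ≠ p)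
    (hΔ₁ : ¬ (ℓ₁ : ℤ) ∣ discOf [a1, a2, a3, a4, a6]) (hΔ₂ : ¬ (ℓ₂ : ℤ) ∣ discOf [a1, a2, a3, a4, a6])
    (hΔ₃ : ¬ (ℓ₃ : ℤ) ∣ discOf [a1, a2, a3, a4, a6])
    {n₁ n₂ n₃ : ℕ} (hc₁ : countPoints [a1, a2, a3, a4, a6] ℓ₁ = n₁)
    (hc₂ : countPoints [a1, a2, a3, a4, a6] ℓ₂ = n₂) (hc₃ : countPoints [a1, a2, a3, a4, a6] ℓ₃ = n₃)
    (r u : ZMod p)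
    (hi : (((ℓ₁ : ℤ) + 1 - n₁ : ℤ) : ZMod p) ^ 2 - 4 * ℓ₁ = r * r ∧
      (((ℓ₁ : ℤ) + 1 - n₁ : ℤ) : ZMod p) ^ 2 - 4 * ℓ₁ ≠ 0 ∧ (((ℓ₁ : ℤ) + 1 - n₁ : ℤ) : ZMod p) ≠ 0)
    (hii : ((((ℓ₂ : ℤ) + 1 - n₂ : ℤ) : ZMod p) ^ 2 - 4 * ℓ₂) ^ (p / 2) = -1 ∧
      (((ℓ₂ : ℤ) + 1 - n₂ : ℤ) : ZMod p) ≠ 0)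
    (hiii : (((ℓ₃ : ℤ) + 1 - n₃ : ℤ) : ZMod p) ^ 2 = u * ℓ₃ ∧
      u ≠ 0 ∧ u ≠ 1 ∧ u ≠ 2 ∧ u ≠ 4 ∧ u ^ 2 - 3 * u + 1 ≠ 0)
    (T : TamLocal) (hTp : T.p = p) (hT : T.check ⟨a1, a2, a3, a4, a6⟩ = true)
    {c : ℕ} (hvals : T.vals = [c]) {w : ℕ} (hw : w ≤ padicValNat p c)
    (hUO : ∀ (K : Type) [Field K] [NumberField K] (n : ℕ) [NeZero n],
      (LocalInvariants.canonical K n).UnramifiedOrthogonal)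
    (hSC : ∀ (K : Type) [Field K] [NumberField K] (n : ℕ) [NeZero n],
      (LocalInvariants.canonical K n).SelmerComplement)
    (hF1 : Gross1991_heegnerPoint_sub_ratTorsion_mem_E0)
    (h372 : GrossLMS1991.prop37_2_frobeniusCongruence)
    (hGZK : rank_eq_analyticRank_of_analyticRank_le_one)
    (hKo : ∀ (N : ℕ) [NeZero N] (W : WeierstrassCurve ℚ) (K : Type) [Field K] [NumberField K], kolyvagin N W K)
    (hmod : exists_isNewformOf)
    (W : WeierstrassCurve ℚ) (hW : W = ⟨a1, a2, a3, a4, a6⟩)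
    {N : ℕ} [NeZero N] {K : Type} [Field K] [NumberField K] (hK : IsImaginaryQuadratic K)
    (hD3 : NumberField.discr K ≠ -3) (hD4 : NumberField.discr K ≠ -4)
    (hH : SatisfiesHeegnerHypothesis N K) {P : (W.baseChange K).toAffine.Point}
    (hP : IsHeegnerPoint N W K P) (hnt : ¬ IsOfFinAddOrder P)
    (hv : padicValNat p (AddSubgroup.zmultiples P).index ≤ w)
    (hr : W.analyticRank ≤ 1) {s : ℚ} (hs : shaAn W = (s : ℂ)) (hvs : padicValRat p s = 0) :
    BSDp W p :=
  bsdp_of_jetRowB5_tam_min_of_swapLiterature p hp hp5 a1 a2 a3 a4 a6 hmin hpΔ hpc₄ ℓ₁ ℓ₂ ℓ₃ hℓ₁ hℓ₂ hℓ₃ h2₁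
    h2₂ h2₃ hne₁ hne₂ hne₃ hΔ₁ hΔ₂ hΔ₃ hc₁ hc₂ hc₃ r u hi hii hiii T hTp hT hvals hw
    (poitouTate_conj_forall_of_canonical hUO hSC) hF1 h372 hGZK hKo hmod W hW hK hD3 hD4 hH hP hnt hv hr hs hvs

/-! ## §3 ONE landed row re-derived through the re-keyed kit -/

/-- **`BSD(E,11)` for `127050cx1` ⟸ {hUO, hSC, F1, Gross 3.7 (2), GZK, Kolyvagin, modularity}** — the landed
record `JET.bsdpJ_127050cx1_11` (`JET/JetDocstrikeARecords01.lean`; register cell `(127050cx1, 11)`, row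
`JET@p∣N` bucket A, road S; carrier `q = 3`, `c_q = 11`; REGISTER DATUM OF RECORD `K = ℚ(√-479)`,
`ord_11 I_K = 1`, NOT re-computed here), re-derived through pv-2's `bsdpJ_127050cx1_11_of_swapLiterature` with
`hPT := poitouTate_conj_forall_of_canonical hUO hSC`: displayed class-free binders {`hUO`, `hSC`, `hF1`, `h372`,
`hGZK`, `hKo`, `hmod`}. CONDITIONAL on every binder; per cell; nothing booked by this file.
[cite: Jetchev2008, Cor. 1.5 (p. 812)] [cite: MilneADT2006, Ch. I, Thm. 2.6, Thm. 4.10(b)]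
[cite: Cremona2006, Table 1 (label 127050cx1)] -/
theorem bsdpJ_127050cx1_11_of_canonicalLiterature
    (hUO : ∀ (K : Type) [Field K] [NumberField K] (n : ℕ) [NeZero n],
      (LocalInvariants.canonical K n).UnramifiedOrthogonal)
    (hSC : ∀ (K : Type) [Field K] [NumberField K] (n : ℕ) [NeZero n],
      (LocalInvariants.canonical K n).SelmerComplement)
    (hF1 : Gross1991_heegnerPoint_sub_ratTorsion_mem_E0)
    (h372 : GrossLMS1991.prop37_2_frobeniusCongruence)
    (hGZK : rank_eq_analyticRank_of_analyticRank_le_one)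
    (hKo : ∀ (N : ℕ) [NeZero N] (W : WeierstrassCurve ℚ) (K : Type) [Field K] [NumberField K], kolyvagin N W K)
    (hmod : exists_isNewformOf)
    (W : WeierstrassCurve ℚ) (hW : W = ⟨1, 0, 1, -17543551, -28549647502⟩)
    {N : ℕ} [NeZero N] {K : Type} [Field K] [NumberField K] (hK : IsImaginaryQuadratic K)
    (hD3 : NumberField.discr K ≠ -3) (hD4 : NumberField.discr K ≠ -4)
    (hH : SatisfiesHeegnerHypothesis N K) {P : (W.baseChange K).toAffine.Point}
    (hP : IsHeegnerPoint N W K P) (hnt : ¬ IsOfFinAddOrder P) (hqN : 3 ∣ N)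
    (hv : padicValNat 11 (AddSubgroup.zmultiples P).index ≤ 1)
    (hr : W.analyticRank ≤ 1) {s : ℚ} (hs : shaAn W = (s : ℂ)) (hvs : padicValRat 11 s = 0) : BSDp W 11 :=
  bsdpJ_127050cx1_11_of_swapLiterature (poitouTate_conj_forall_of_canonical hUO hSC) hF1 h372 hGZK hKo hmod W
    hW hK hD3 hD4 hH hP hnt hqN hv hr hs hvs

end Summit.BirchSwinnertonDyer.Rank1Residual.JET

end
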